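import Literature.NumberTheory.EllipticCurves.BigRepModuleDualShiftedEndomorphismCofinitelyGeneratedProofs
import Literature.NumberTheory.EllipticCurves.SigmaEulerFactors
import Mathlib.Algebra.Polynomial.Reverse
import HarnessLib

/-!
# The intrinsic Euler factor `P((1+T)^{−c})`, `P = (charpoly Frob_w).reverse`, versus the tree's
# `SigmaEulerFactors.eulerFactor`: the algebraic bridge (theorems only)

Topic `NumberTheory/EllipticCurves`; namespace `Literature.NumberTheory.EllipticCurves`. THEOREMS ONLY (no
definition, no named fact, no `sorry`). Cell `bsd-stepL`, K2 support 20495 (`JSWSigmaLocalCharIdeal`), module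
L5 step (S5); seat `bsd-stepL-imc-p1` g13.

The general finitely decomposed local term (`BigRepLocalTermCofinitelyGeneratedProofs`,
`JetchevSkinnerWan2017.sigmaLocal_dual_of_ne_zero`) puts `P((1+T)^{−c}) ∈ Ch_Λ(X_w)` with
`P = (LinearMap.charpoly Lt).reverse`, `Lt` the Frobenius on the lattice `Y = H¹(I_w, E[p^∞])^∨ ⧸ tors`
([GreenbergVatsal2000] p. 22: `𝓟_ℓ = P_ℓ(ℓ⁻¹γ_ℓ)`, `P_ℓ(X) = det(1 − X·Frob_ℓ)`), while the atom
(`Summit…SigmaLocal.sigmaLocal_of_eulerFactor_mem_span_intrinsic`) wants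
`eulerFactor p ℤ_[p] Nw t c ∈ (P((1+T)^{−c}))`. This file is the polynomial algebra in `Λ = ℤ_p⟦T⟧`
closing that gap ONCE THE CHARACTERISTIC POLYNOMIAL OF FROBENIUS ON `Y` IS KNOWN:

* `aeval_onePlusTPow_eq_aeval_binomSeries_neg_reverse_mul` — `Q(u) = Q^rev(u⁻¹) · u^{deg Q}` for
  `u = (1+T)^c`, `u⁻¹ = (1+T)^{−c} = binomSeries ℤ_[p] (−c)` (Mathlib `eval₂_reverse_mul_pow`);
* `mem_span_aeval_binomSeries_neg_reverse_of_eq_C_mul_aeval` — anything of the form `C r · Q(u)` lies in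
  `(Q^rev(u⁻¹))`;
* `eulerFactor_good_mem_span_of_charpoly_eq` — **good reduction**: if `charpoly Lt = X² − (a/q)X + 1/q`
  (`q = Nw` a `p`-adic unit; Frobenius eigenvalues `α/q, β/q` on `T_p(E)(−1)`-type lattice) then
  `eulerFactor p ℤ_[p] Nw (.good a) c = q·u² − a·u + 1 ∈ (P((1+T)^{−c}))`;
* `eulerFactor_splitMult_mem_span_of_charpoly_eq` ∕ `eulerFactor_nonsplitMult_mem_span_of_charpoly_eq` —
  **multiplicative reduction**: `charpoly Lt = X − 1/q`, resp. `X + 1/q` (the toric line twisted by `−1`)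
  gives `q·u − 1`, resp. `q·u + 1`.

So after this file, (S5) = the COMPUTATION of `charpoly Lt` by reduction type (the `A_{I_w}(−1)`-structure
of `H¹(I_w, E[p^∞])_div`), nothing else.

References: [GreenbergVatsal2000] Prop. 2.4 and proof (arXiv p. 22); [Skinner2016PacificMC] §2.3 (p. 180,
`P_ℓ(X) = det(1 − X·frob_ℓ | V_{I_ℓ})`); [JetchevSkinnerWan2017] §5.1.
-/

noncomputable section

open Polynomial

namespace Literature.NumberTheory.EllipticCurves

open IwasawaCharacter

variable {p : ℕ} [Fact p.Prime]

/-- **`Q((1+T)^c) = Q^rev((1+T)^{−c}) · ((1+T)^c)^{deg Q}`** in `Λ = ℤ_p⟦T⟧` (`Q^rev = Polynomial.reverse Q`;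
Mathlib `eval₂_reverse_mul_pow` at the unit `(1+T)^c`, whose inverse is `binomSeries ℤ_[p] (−c)`).
[cite: GreenbergVatsal2000, proof of Prop. 2.4 (arXiv p. 22: 𝓟_ℓ = P_ℓ(ℓ⁻¹γ_ℓ))] -/
theorem aeval_onePlusTPow_eq_aeval_binomSeries_neg_reverse_mul (c : ℤ_[p]) (Q : ℤ_[p][X]) :
    aeval ((onePlusTPow p ℤ_[p] c : (PowerSeries ℤ_[p])ˣ) : PowerSeries ℤ_[p]) Q =
      aeval (BigRepModule.binomSeries ℤ_[p] (-c)) Q.reverse *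
        ((onePlusTPow p ℤ_[p] c : (PowerSeries ℤ_[p])ˣ) : PowerSeries ℤ_[p]) ^ Q.natDegree := by
  have hv : BigRepModule.binomSeries ℤ_[p] (-c) =
      ⅟((onePlusTPow p ℤ_[p] c : (PowerSeries ℤ_[p])ˣ) : PowerSeries ℤ_[p]) := by
    rw [invOf_units, BigRepModule.binomSeries_eq_binomialSeries, val_inv_onePlusTPow]
  rw [hv, aeval_def, aeval_def, eval₂_reverse_mul_pow]

/-- Anything of the form `C r · Q((1+T)^c)` lies in the principal ideal `(Q^rev((1+T)^{−c}))` of `Λ`.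
[cite: GreenbergVatsal2000, proof of Prop. 2.4 (arXiv p. 22)] -/
theorem mem_span_aeval_binomSeries_neg_reverse_of_eq_C_mul_aeval (c : ℤ_[p]) (Q : ℤ_[p][X])
    (r : ℤ_[p]) {E : PowerSeries ℤ_[p]}
    (hE : E = PowerSeries.C r *
      aeval ((onePlusTPow p ℤ_[p] c : (PowerSeries ℤ_[p])ˣ) : PowerSeries ℤ_[p]) Q) :
    E ∈ Ideal.span {aeval (BigRepModule.binomSeries ℤ_[p] (-c)) Q.reverse} := by
  rw [hE, aeval_onePlusTPow_eq_aeval_binomSeries_neg_reverse_mul]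
  exact Ideal.mul_mem_left _ _ (Ideal.mul_mem_right _ _ (Ideal.mem_span_singleton_self _))

/-- Evaluation of a polynomial at `u = (1+T)^c`: constants go to `PowerSeries.C`. [folklore] -/
private theorem aeval_C_onePlusTPow (c : ℤ_[p]) (r : ℤ_[p]) :
    aeval ((onePlusTPow p ℤ_[p] c : (PowerSeries ℤ_[p])ˣ) : PowerSeries ℤ_[p]) (C r) =
      PowerSeries.C r := by
  rw [aeval_C]; rfl

/-- **Good reduction.** If the Frobenius on the lattice `Y` has characteristic polynomial
`X² − (a/q)·X + 1/q` (`q = Nw ∈ ℤ_p^×`), then `eulerFactor p ℤ_[p] Nw (.good a) c = q·u² − a·u + 1`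
(`u = (1+T)^c`) lies in `(P((1+T)^{−c}))`, `P = (charpoly).reverse`: indeed `q·(u² − (a/q)u + 1/q) = q u² − a u + 1`.
[cite: GreenbergVatsal2000, Prop. 2.4 and proof (arXiv p. 22)] [cite: Skinner2016PacificMC, §2.3 (p. 180)] -/
theorem eulerFactor_good_mem_span_of_charpoly_eq {Y : Type*} [AddCommGroup Y] [Module ℤ_[p] Y]
    [Module.Free ℤ_[p] Y] [Module.Finite ℤ_[p] Y] (Lt : Y →ₗ[ℤ_[p]] Y) (Nw : ℕ) (a : ℤ) (c : ℤ_[p])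
    (n : ℤ_[p]ˣ) (hn : (n : ℤ_[p]) = Nw)
    (hchar : LinearMap.charpoly Lt =
      X ^ 2 - C ((a : ℤ_[p]) * (↑n⁻¹ : ℤ_[p])) * X + C (↑n⁻¹ : ℤ_[p])) :
    eulerFactor p ℤ_[p] Nw (.good a) c ∈
      Ideal.span {aeval (BigRepModule.binomSeries ℤ_[p] (-c)) (LinearMap.charpoly Lt).reverse} := by
  refine mem_span_aeval_binomSeries_neg_reverse_of_eq_C_mul_aeval c _ (n : ℤ_[p]) ?_
  set u : PowerSeries ℤ_[p] := ((onePlusTPow p ℤ_[p] c : (PowerSeries ℤ_[p])ˣ) : PowerSeries ℤ_[p])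
    with hu
  rw [hchar, map_add, map_sub, map_mul, map_pow, aeval_X, aeval_C_onePlusTPow, aeval_C_onePlusTPow,
    eulerFactor_good]
  have h1 : PowerSeries.C (n : ℤ_[p]) * PowerSeries.C (↑n⁻¹ : ℤ_[p]) = 1 := by
    rw [← map_mul, Units.mul_inv, map_one]
  have h2 : PowerSeries.C (n : ℤ_[p]) * PowerSeries.C ((a : ℤ_[p]) * (↑n⁻¹ : ℤ_[p])) =
      (a : PowerSeries ℤ_[p]) := by
    rw [← map_mul, mul_comm (a : ℤ_[p]) _, Units.mul_inv_cancel_left, map_intCast]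
  have hNw : (Nw : PowerSeries ℤ_[p]) = PowerSeries.C (n : ℤ_[p]) := by
    rw [hn, map_natCast]
  rw [hNw]
  linear_combination u * h2 - h1

/-- **Split multiplicative reduction.** If the Frobenius on the (rank one) lattice `Y` has characteristic
polynomial `X − 1/q`, then `eulerFactor p ℤ_[p] Nw .splitMult c = q·u − 1 ∈ (P((1+T)^{−c}))`.
[cite: GreenbergVatsal2000, Prop. 2.4 and proof (arXiv p. 22)] [cite: Skinner2016PacificMC, §2.3 (p. 180)] -/
theorem eulerFactor_splitMult_mem_span_of_charpoly_eq {Y : Type*} [AddCommGroup Y] [Module ℤ_[p] Y]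
    [Module.Free ℤ_[p] Y] [Module.Finite ℤ_[p] Y] (Lt : Y →ₗ[ℤ_[p]] Y) (Nw : ℕ) (c : ℤ_[p])
    (n : ℤ_[p]ˣ) (hn : (n : ℤ_[p]) = Nw)
    (hchar : LinearMap.charpoly Lt = X - C (↑n⁻¹ : ℤ_[p])) :
    eulerFactor p ℤ_[p] Nw .splitMult c ∈
      Ideal.span {aeval (BigRepModule.binomSeries ℤ_[p] (-c)) (LinearMap.charpoly Lt).reverse} := by
  refine mem_span_aeval_binomSeries_neg_reverse_of_eq_C_mul_aeval c _ (n : ℤ_[p]) ?_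
  rw [hchar, map_sub, aeval_X, aeval_C_onePlusTPow, eulerFactor_splitMult]
  have h1 : PowerSeries.C (n : ℤ_[p]) * PowerSeries.C (↑n⁻¹ : ℤ_[p]) = 1 := by
    rw [← map_mul, Units.mul_inv, map_one]
  have hNw : (Nw : PowerSeries ℤ_[p]) = PowerSeries.C (n : ℤ_[p]) := by
    rw [hn, map_natCast]
  rw [hNw]
  linear_combination h1

/-- **Non-split multiplicative reduction.** If the Frobenius on the (rank one) lattice `Y` has
characteristic polynomial `X + 1/q`, then `eulerFactor p ℤ_[p] Nw .nonsplitMult c = q·u + 1 ∈ (P((1+T)^{−c}))`.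
[cite: GreenbergVatsal2000, Prop. 2.4 and proof (arXiv p. 22)] [cite: Skinner2016PacificMC, §2.3 (p. 180)] -/
theorem eulerFactor_nonsplitMult_mem_span_of_charpoly_eq {Y : Type*} [AddCommGroup Y] [Module ℤ_[p] Y]
    [Module.Free ℤ_[p] Y] [Module.Finite ℤ_[p] Y] (Lt : Y →ₗ[ℤ_[p]] Y) (Nw : ℕ) (c : ℤ_[p])
    (n : ℤ_[p]ˣ) (hn : (n : ℤ_[p]) = Nw)
    (hchar : LinearMap.charpoly Lt = X + C (↑n⁻¹ : ℤ_[p])) :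
    eulerFactor p ℤ_[p] Nw .nonsplitMult c ∈
      Ideal.span {aeval (BigRepModule.binomSeries ℤ_[p] (-c)) (LinearMap.charpoly Lt).reverse} := by
  refine mem_span_aeval_binomSeries_neg_reverse_of_eq_C_mul_aeval c _ (n : ℤ_[p]) ?_
  rw [hchar, map_add, aeval_X, aeval_C_onePlusTPow, eulerFactor_nonsplitMult]
  have h1 : PowerSeries.C (n : ℤ_[p]) * PowerSeries.C (↑n⁻¹ : ℤ_[p]) = 1 := by
    rw [← map_mul, Units.mul_inv, map_one]
  have hNw : (Nw : PowerSeries ℤ_[p]) = PowerSeries.C (n : ℤ_[p]) := by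
    rw [hn, map_natCast]
  rw [hNw]
  linear_combination -h1

end Literature.NumberTheory.EllipticCurves

end
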